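import Mathlib.Algebra.Group.Subsemigroup.Basic
import Mathlib.Algebra.Order.Monoid.Defs
import Mathlib.Algebra.Order.Monoid.Unbundled.Basic
import Literature.IUT.HodgeArakelov.TemperedThetaMonoids

/-!
# [IUTchII] §3, Prop 3.1 / Ex 3.2 — proof companion (discharge of the statement-level clauses over
# the REAL theta monoids of `TemperedThetaMonoids.lean`)

S. Mochizuki, *Inter-universal Teichmüller theory II*, §3 "Tempered Gaussian Frobenioids" (kurims
Dec-2020 manuscript): Proposition 3.1 (i)(ii) pp. 87–88, Example 3.2 (i)(ii) pp. 88–89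
[cite: Mochizuki2012, Prop 3.1 p.87]. Claim key DISPUTED (D-0012); PROOF-ONLY companion
(abc-iut cell, layer L6, wave-3 discharge seat abc-iut-L6-d3; node ids IUTchII:Prop3.1(i),
IUTchII:Prop3.1(ii), IUTchII:Ex3.2(i), IUTchII:Ex3.2(ii)). Nothing here asserts a disputed claim or
takes a side on [IUTchIII] Cor 3.12: every theorem is elementary commutative-monoid algebra about
the submonoids `Ψ = U · θ^ℕ`, `∞Ψ = U · θ^{ℚ≥0}` DEFINED in the statement file, and says exactly which
hypotheses on the INPUT data (owned upstream: [EtTh] mono-theta environments, [IUTchI] Ex 3.2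
tempered Frobenioids — TODO-merge abc-iut-L6-t1 / abc-iut-L5-t2) make the printed property clauses
(the `Prop`-valued fields of `Prop31Statements`, `Example32Statements`) hold.

What is PROVED (all unconditional theorems about the typed objects):

* `mem_rootPowers_iff`: as a set, `θ^{ℚ≥0} = {x | ∃ a b > 0, x^a = θ^b} ∪ {1}` (the statement file
  recorded only closure under products); `rootPowers_map_mulEquiv`: `θ^{ℚ≥0}` is transported by
  group automorphisms (`e(θ^{ℚ≥0}) = e(θ)^{ℚ≥0}`).
* **Splittings up to torsion** ([IUTchII] Prop 3.1 (i) p. 87 "splittings up to torsion determined by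
  the subsets `M^×_TM`, `θ^ι_env`, `∞θ^ι_env`"; Ex 3.2 (i) p. 89 "`Θ^{ℚ≥0}_v` determines characteristic
  splittings, up to torsion"): the typed predicate `IsSplittingUpToTorsion U S` HOLDS as soon as the
  theta data lie in a multiplicatively closed set `S⁺` ("elements of positive order") containing no
  element of the unit group `U` — `isSplittingUpToTorsion_closure_of_subsemigroup`,
  `isSplittingUpToTorsion_rootPowers_of_subsemigroup` — in particular as soon as there is a
  homomorphism `v` ("order of the divisor of zeroes/poles") to an ordered monoid killing `U` and
  positive on the theta data (`…_of_val`). In that situation the unit part and the theta part meet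
  only in `1` (`inf_eq_bot` versions). This is precisely the mechanism of the printed model
  (`Θ_v` has a non-trivial divisor, units have trivial divisor); the divisor map itself is upstream
  data ([FrdI] Def 1.1 `Div`, [IUTchI] Ex 3.2 (v) `τ^Θ_v`).
* **Conjugation action** (Prop 3.1 (i) p. 87 "this collection of subsets is equipped with a natural
  conjugation action by `Π_X(M^Θ_*)`"; Ex 3.2 (i) p. 89): if the action stabilises the unit group and
  permutes the INPUT subsets `θ^ι_env` (the content of Prop 2.2 (i): conjugates of inversion
  automorphisms are inversion automorphisms), then it permutes the theta monoids `Ψ^ι_env`, `∞Ψ^ι_env`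
  accordingly (`thetaMonoid_map_conj`, `inftyThetaMonoid_map_conj`, hence the field
  `Prop31Statements.conj_permutes`); the `∞`-version of the statement file's `frobThetaMonoid_conj`
  (`inftyFrobThetaMonoid_conj`: `β · ∞Ψ_{F^Θ_v,α} = ∞Ψ_{F^Θ_v,βα}`).
* **Units of the constant monoid** (Prop 3.1 (ii) p. 88, `Ψ_cns = M_TM ⊇ M^×_TM`): stability of `M_TM`
  under the action implies stability of `M^×_TM` (`units_conjStable_of_constants`), and `M^×_TM` is
  exactly the group of invertible elements of the monoid `M_TM` (`isUnit_constantMonoid_iff`).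
* ASSEMBLY: `prop31Statements_of_val` / `example32Statements_of_val` — the two `Prop`-valued
  statement structures of the statement file hold under the named input hypotheses; and
  `example32Statements_iff_id` — the `α`-indexed splitting clause of Ex 3.2 (i) is equivalent to
  the single clause at `α = 1` once the units are `Π_v`-stable ("compatible with the action of `Π_v`").

Per-node outcome (DISCHARGE-L6 §E2 vocabulary): IUTchII:Prop3.1(i) PROVED-modulo-inputs (the
monoids are REAL; every property clause is reduced to named hypotheses on the Prop 1.5 / Cor 2.8
input subsets); IUTchII:Prop3.1(ii) PROVED (unit-group clause) + SLOT ("naturally isomorphic to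
`O^▷_{F̄_v}`": NEEDS the cyclotomic rigidity isomorphisms of Cors 2.8 (i), 2.9, abc-iut-L6-t1);
IUTchII:Ex3.2(i) PROVED-modulo-inputs (conjugation action on `∞Ψ`, splittings from a divisor map);
IUTchII:Ex3.2(ii) SLOT (`Ψ_{C_v} := O^▷_{C_v}(A^Θ_∞)` and its `Π_v`-action are the fields `baseMonoid`,
`base_stable`; NEEDS [IUTchI] Ex 3.2 (iii) — abc-iut-L5-t2 `BadLocalFrobenioid` — and [FrdI] Prop
2.2). The MEDIUM rows Prop3.3(i)(ii), Prop3.4(i)(ii), Cor3.7(i)(ii) of the same statement file are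
output-signature / `Prop`-slot structures (`Prop33KummerStatements`, `RadialityStatements`): SLOT,
merge-gated on abc-iut-L6-t1 (Ex 1.7/1.8 radial environments, Prop 1.3 Kummer classes) and
abc-iut-L5-t2; nothing in them is provable before those objects are real, and nothing is claimed.
-/

namespace Literature.IUT.HodgeArakelov

namespace TemperedThetaMonoids

universe u v w

/-! ### 0. Two facts about `ξ^{ℚ≥0}` (`rootPowers`) that the statement files leave implicit -/

section RootPowers

variable {N : Type w} [CommMonoid N]

/-- Membership in `ξ^{ℚ≥0}` ([IUTchII] Ex 3.2 (i) p. 88: "the set of elements for which some [positive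
integer] power is equal to a [positive integer] power of" `ξ`), for the submonoid `rootPowers ξ`
GENERATED by that set: since the printed set is closed under products (`rootPowerSet_mul_mem`), the
submonoid only adds the empty product `1`. [cite: Mochizuki2012, Ex 3.2 (i) p.88] -/
theorem mem_rootPowers_iff (ξ x : N) : x ∈ rootPowers ξ ↔ x = 1 ∨ x ∈ rootPowerSet ξ := by
  constructor
  · intro hx
    induction hx using Submonoid.closure_induction with
    | mem y hy => exact Or.inr hy
    | one => exact Or.inl rfl
    | mul y z _ _ ihy ihz =>
      rcases ihy with rfl | hy
      · simpa using ihz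
      · rcases ihz with rfl | hz
        · exact Or.inr (by simpa using hy)
        · exact Or.inr (rootPowerSet_mul_mem ξ hy hz)
  · rintro (rfl | hx)
    · exact one_mem _
    · exact Submonoid.subset_closure hx

/-- The printed set `{x | ∃ a b > 0, x^a = ξ^b}` is transported by any multiplicative equivalence:
`e '' rootPowerSet ξ = rootPowerSet (e ξ)`. [cite: Mochizuki2012, Ex 3.2 (i) p.88] -/
theorem image_rootPowerSet_mulEquiv {N' : Type*} [CommMonoid N'] (e : N ≃* N') (ξ : N) :
    e '' rootPowerSet ξ = rootPowerSet (e ξ) := by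
  ext y
  constructor
  · rintro ⟨x, ⟨a, b, ha, hb, hx⟩, rfl⟩
    exact ⟨a, b, ha, hb, by rw [← map_pow, hx, map_pow]⟩
  · rintro ⟨a, b, ha, hb, hy⟩
    refine ⟨e.symm y, ⟨a, b, ha, hb, ?_⟩, by simp⟩
    apply e.injective
    rw [map_pow, MulEquiv.apply_symm_apply, hy, map_pow]

/-- `ξ^{ℚ≥0}` is transported by any multiplicative equivalence `e`: `e(ξ^{ℚ≥0}) = e(ξ)^{ℚ≥0}` — the
monoid-level fact behind "a natural conjugation action of `Π_v` on the collections of submonoids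
`∞Ψ_{F^Θ_v}`" ([IUTchII] Ex 3.2 (i) p. 89). [cite: Mochizuki2012, Ex 3.2 (i) p.89] -/
theorem rootPowers_map_mulEquiv {N' : Type*} [CommMonoid N'] (e : N ≃* N') (ξ : N) :
    (rootPowers ξ).map e.toMonoidHom = rootPowers (e ξ) := by
  unfold rootPowers
  rw [MonoidHom.map_mclosure]
  congr 1
  exact image_rootPowerSet_mulEquiv e ξ

end RootPowers

/-! ### 1. Splittings up to torsion from a "positive cone" / a divisor map -/

section Splittings

variable {H : Type u} [CommGroup H]

/-- If a multiplicatively closed set `S⁺ ⊆ H` ("elements with a non-trivial divisor of zeroes") is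
disjoint from the subgroup `U` ("units: trivial divisor") and contains the subset `T`, then the
submonoid generated by `T` meets `U` only in `1`. This is the mechanism of the printed "splitting up
to torsion determined by the subsets `M^×_TM`, `θ^ι_env`, `∞θ^ι_env`" ([IUTchII] Prop 3.1 (i) p. 87).
[cite: Mochizuki2012, Prop 3.1 (i) p.87] -/
theorem eq_one_of_mem_closure_of_subsemigroup (S : Subsemigroup H) (U : Subgroup H) (T : Set H)
    (hT : T ⊆ S) (hSU : ∀ x ∈ S, x ∉ U) {x : H} (hxT : x ∈ Submonoid.closure T) (hxU : x ∈ U) :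
    x = 1 := by
  -- every element of the closure is `1` or lies in `S⁺`
  have key : ∀ y : H, y ∈ Submonoid.closure T → y = 1 ∨ y ∈ S := by
    intro y hy
    induction hy using Submonoid.closure_induction with
    | mem y hy => exact Or.inr (hT hy)
    | one => exact Or.inl rfl
    | mul y z _ _ ihy ihz =>
      rcases ihy with rfl | hy
      · simpa using ihz
      · rcases ihz with rfl | hz
        · exact Or.inr (by simpa using hy)
        · exact Or.inr (S.mul_mem hy hz)
  rcases key x hxT with rfl | hxS
  · rfl
  · exact absurd hxU (hSU x hxS)

/-- Under the hypothesis of `eq_one_of_mem_closure_of_subsemigroup`, the pair `(U, ⟨T⟩)` is a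
splitting up to torsion in the sense of the statement file ([IUTchII] Prop 3.1 (i) p. 87) — indeed the
only common element is `1`. [cite: Mochizuki2012, Prop 3.1 (i) p.87] -/
theorem isSplittingUpToTorsion_closure_of_subsemigroup (S : Subsemigroup H) (U : Subgroup H)
    (T : Set H) (hT : T ⊆ S) (hSU : ∀ x ∈ S, x ∉ U) :
    IsSplittingUpToTorsion U (Submonoid.closure T) :=
  ⟨fun x hxU hxT => by
    rw [eq_one_of_mem_closure_of_subsemigroup S U T hT hSU hxT hxU]
    exact IsOfFinOrder.one⟩

/-- The `ℚ≥0`-version: if `θ` lies in a multiplicatively closed set `S⁺` disjoint from `U`, then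
`U ∩ θ^{ℚ≥0} = {1}`, so `(U, θ^{ℚ≥0})` is a splitting up to torsion ("`Θ^{ℚ≥0}_v|_{A^Θ_∞}` determines
characteristic splittings, up to torsion, of the monoids `Ψ_{F^Θ_v,α}`, `∞Ψ_{F^Θ_v,α}`", [IUTchII] Ex 3.2
(i) p. 89): an element `u ∈ U` with `u^a = θ^b`, `a, b > 0`, would put `θ^b ∈ S⁺` into `U`.
[cite: Mochizuki2012, Ex 3.2 (i) p.89] -/
theorem eq_one_of_mem_rootPowers_of_subsemigroup (S : Subsemigroup H) (U : Subgroup H) (θ : H)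
    (hθ : θ ∈ S) (hSU : ∀ x ∈ S, x ∉ U) {x : H} (hxθ : x ∈ rootPowers θ) (hxU : x ∈ U) :
    x = 1 := by
  rcases (mem_rootPowers_iff θ x).mp hxθ with rfl | ⟨a, b, ha, hb, hx⟩
  · rfl
  · exfalso
    have hθb : θ ^ b ∈ S := by
      obtain ⟨c, rfl⟩ := Nat.exists_eq_add_of_lt hb
      -- θ^(0+c+1) = θ^c * θ : products of elements of S stay in S
      clear hb hx
      induction c with
      | zero => simpa using hθ
      | succ c ih =>
        rw [show 0 + (c + 1) + 1 = (0 + c + 1) + 1 from rfl, pow_succ]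
        exact S.mul_mem ih hθ
    exact hSU _ hθb (hx ▸ U.pow_mem hxU a)

/-- Hence `(U, θ^{ℚ≥0})` is a splitting up to torsion under that hypothesis ([IUTchII] Ex 3.2 (i)
p. 89). [cite: Mochizuki2012, Ex 3.2 (i) p.89] -/
theorem isSplittingUpToTorsion_rootPowers_of_subsemigroup (S : Subsemigroup H) (U : Subgroup H)
    (θ : H) (hθ : θ ∈ S) (hSU : ∀ x ∈ S, x ∉ U) : IsSplittingUpToTorsion U (rootPowers θ) :=
  ⟨fun x hxU hxθ => by
    rw [eq_one_of_mem_rootPowers_of_subsemigroup S U θ hθ hSU hxθ hxU]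
    exact IsOfFinOrder.one⟩

variable {Γ : Type v} [CommMonoid Γ] [PartialOrder Γ] [IsOrderedMonoid Γ]

/-- The "positive cone" of a homomorphism `v : H → Γ` to an ordered commutative monoid (a divisor /
order map): the elements with `1 < v x`; it is multiplicatively closed. [folklore] -/
private theorem one_lt_map_mul_of_one_lt (v : H →* Γ) {x y : H} (hx : 1 < v x) (hy : 1 < v y) :
    1 < v (x * y) := by
  rw [map_mul]
  exact one_lt_mul'' hx hy

/-- DIVISOR-MAP FORM of the splitting clause of [IUTchII] Prop 3.1 (i) p. 87: if a homomorphism `v`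
to an ordered commutative monoid kills the unit group `U` (`v u = 1`) and is `> 1` on every element
of `T` (the theta classes have a non-trivial divisor of zeroes), then `(U, ⟨T⟩)` is a splitting up to
torsion. [cite: Mochizuki2012, Prop 3.1 (i) p.87] -/
theorem isSplittingUpToTorsion_closure_of_val (v : H →* Γ) (U : Subgroup H) (T : Set H)
    (hU : ∀ u ∈ U, v u = 1) (hT : ∀ t ∈ T, 1 < v t) :
    IsSplittingUpToTorsion U (Submonoid.closure T) := by
  let S : Subsemigroup H := ⟨{x | 1 < v x}, fun {x y} hx hy => one_lt_map_mul_of_one_lt v hx hy⟩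
  refine isSplittingUpToTorsion_closure_of_subsemigroup S U T (fun t ht => hT t ht) ?_
  intro x hx hxU
  have h1 : (1 : Γ) < v x := hx
  rw [hU x hxU] at h1
  exact lt_irrefl _ h1

/-- DIVISOR-MAP FORM of the splitting clause of [IUTchII] Ex 3.2 (i) p. 89: if `v` kills `U` and
`1 < v θ`, then `(U, θ^{ℚ≥0})` is a splitting up to torsion. [cite: Mochizuki2012, Ex 3.2 (i) p.89] -/
theorem isSplittingUpToTorsion_rootPowers_of_val (v : H →* Γ) (U : Subgroup H) (θ : H)
    (hU : ∀ u ∈ U, v u = 1) (hθ : 1 < v θ) : IsSplittingUpToTorsion U (rootPowers θ) := by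
  let S : Subsemigroup H := ⟨{x | 1 < v x}, fun {x y} hx hy => one_lt_map_mul_of_one_lt v hx hy⟩
  refine isSplittingUpToTorsion_rootPowers_of_subsemigroup S U θ hθ ?_
  intro x hx hxU
  have h1 : (1 : Γ) < v x := hx
  rw [hU x hxU] at h1
  exact lt_irrefl _ h1

/-- A splitting up to torsion is transported along a multiplicative equivalence that stabilises the
unit group: if `(U, S)` is one, so is `(U, e(S))` whenever `e⁻¹(U) ⊆ U` — the monoid-level content of
"characteristic splittings, up to torsion, … compatible with the action of `Π_v`" ([IUTchII] Ex 3.2 (i)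
p. 89). [cite: Mochizuki2012, Ex 3.2 (i) p.89] -/
theorem IsSplittingUpToTorsion.map (e : H ≃* H) {U : Subgroup H} {S : Submonoid H}
    (h : IsSplittingUpToTorsion U S) (hU : ∀ x, x ∈ U → e.symm x ∈ U) :
    IsSplittingUpToTorsion U (S.map e.toMonoidHom) := by
  refine ⟨fun x hxU hxS => ?_⟩
  obtain ⟨y, hy, rfl⟩ := Submonoid.mem_map.mp hxS
  have hyU : y ∈ U := by simpa using hU _ hxU
  exact e.toMonoidHom.isOfFinOrder (h.inter_torsion y hyU hy)

end Splittings

/-! ### 2. Proposition 3.1 (i): the theta monoids `Ψ^ι_env = M^×_TM · θ^ι_env^ℕ` -/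

section Prop31

variable {P : Type u} [Group P] (E : ThetaEnvData.{u, v} P)

/-- **IUTchII:Prop3.1(i)** (kurims p.87) "the submonoids … generated … by the subsets
`M^×_TM · θ^ι_env(M^Θ_*)`": the statement file's `Ψ^ι_env := M^×_TM ⊔ ⟨θ^ι_env⟩` IS the submonoid
generated by `M^×_TM ∪ θ^ι_env`. [cite: Mochizuki2012, Prop 3.1 (i) p.87] -/
theorem thetaMonoid_eq_closure (ι : E.Iota) :
    E.thetaMonoid ι = Submonoid.closure ((E.units : Set E.H) ∪ E.thetaEnv ι) := by
  rw [Submonoid.closure_union, ← Subgroup.coe_toSubmonoid, Submonoid.closure_eq]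
  rfl

/-- **IUTchII:Prop3.1(i)** (kurims p.87) `∞`-version: `∞Ψ^ι_env` is the submonoid generated by
`M^×_TM ∪ ∞θ^ι_env`. [cite: Mochizuki2012, Prop 3.1 (i) p.87] -/
theorem inftyThetaMonoid_eq_closure (ι : E.Iota) :
    E.inftyThetaMonoid ι = Submonoid.closure ((E.units : Set E.H) ∪ E.inftyThetaEnv ι) := by
  rw [Submonoid.closure_union, ← Subgroup.coe_toSubmonoid, Submonoid.closure_eq]
  rfl

/-- **IUTchII:Prop3.1(i)** (kurims p.87) membership in `Ψ^ι_env = M^×_TM · θ^ι_env^ℕ`: every element is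
a unit times a finite product of elements of `θ^ι_env`. [cite: Mochizuki2012, Prop 3.1 (i) p.87] -/
theorem mem_thetaMonoid_iff (ι : E.Iota) (x : E.H) :
    x ∈ E.thetaMonoid ι ↔ ∃ u ∈ E.units, ∃ s ∈ Submonoid.closure (E.thetaEnv ι), u * s = x :=
  mem_splitMonoid_iff _ _ _

/-- **IUTchII:Prop3.1(i)** (kurims p.87) `M^×_TM ⊆ Ψ^ι_env` (the `n = 0` part of `M^×_TM · θ^ℕ`).
[cite: Mochizuki2012, Prop 3.1 (i) p.87] -/
theorem units_le_thetaMonoid (ι : E.Iota) : E.units.toSubmonoid ≤ E.thetaMonoid ι := le_sup_left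

/-- **IUTchII:Prop3.1(i)** (kurims p.87) `θ^ι_env ⊆ Ψ^ι_env`. [cite: Mochizuki2012, Prop 3.1 (i) p.87] -/
theorem thetaEnv_subset_thetaMonoid (ι : E.Iota) : E.thetaEnv ι ⊆ E.thetaMonoid ι :=
  fun _ hx => (le_sup_right : Submonoid.closure (E.thetaEnv ι) ≤ E.thetaMonoid ι)
    (Submonoid.subset_closure hx)

/-- **IUTchII:Prop3.1(i)** (kurims p.87) `∞θ^ι_env ⊆ ∞Ψ^ι_env`. [cite: Mochizuki2012, Prop 3.1 (i) p.87] -/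
theorem inftyThetaEnv_subset_inftyThetaMonoid (ι : E.Iota) :
    E.inftyThetaEnv ι ⊆ E.inftyThetaMonoid ι :=
  fun _ hx => (le_sup_right : Submonoid.closure (E.inftyThetaEnv ι) ≤ E.inftyThetaMonoid ι)
    (Submonoid.subset_closure hx)

/-- The image of the unit subgroup under an automorphism that stabilises it in both directions is
itself (bookkeeping for the conjugation action). [folklore] -/
private theorem map_units_eq_of_stable (g : P)
    (hU : ∀ (g : P) (x : E.H), x ∈ E.units → E.conj g x ∈ E.units) :
    E.units.toSubmonoid.map (E.conj g).toMonoidHom = E.units.toSubmonoid := by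
  ext x
  simp only [Submonoid.mem_map, Subgroup.mem_toSubmonoid, MulEquiv.toMonoidHom_eq_coe,
    MonoidHom.coe_coe]
  constructor
  · rintro ⟨y, hy, rfl⟩; exact hU g y hy
  · intro hx
    refine ⟨(E.conj g).symm x, ?_, by simp⟩
    have := hU g⁻¹ x hx
    rwa [map_inv, MulAut.inv_def] at this

/-- **IUTchII:Prop3.1(i)** (kurims p.87) "this collection of subsets is equipped with a natural
conjugation action by `Π_X(M^Θ_*)`": if `g ∈ Π_X(M^Θ_*)` stabilises `M^×_TM` and carries the INPUT subset
`θ^ι_env` onto `θ^{ι'}_env` (Prop 2.2 (i): conjugates of inversion automorphisms), then it carries the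
theta monoid `Ψ^ι_env` onto `Ψ^{ι'}_env`. [cite: Mochizuki2012, Prop 3.1 (i) p.87] -/
theorem thetaMonoid_map_conj (g : P) {ι ι' : E.Iota}
    (hU : ∀ (g : P) (x : E.H), x ∈ E.units → E.conj g x ∈ E.units)
    (hθ : E.conj g '' E.thetaEnv ι = E.thetaEnv ι') :
    (E.thetaMonoid ι).map (E.conj g).toMonoidHom = E.thetaMonoid ι' := by
  unfold ThetaEnvData.thetaMonoid splitMonoid
  rw [Submonoid.map_sup, map_units_eq_of_stable E g hU, MonoidHom.map_mclosure]
  congr 2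

/-- **IUTchII:Prop3.1(i)** (kurims p.87) the same for `∞Ψ^ι_env`. [cite: Mochizuki2012, Prop 3.1 (i) p.87] -/
theorem inftyThetaMonoid_map_conj (g : P) {ι ι' : E.Iota}
    (hU : ∀ (g : P) (x : E.H), x ∈ E.units → E.conj g x ∈ E.units)
    (hθ : E.conj g '' E.inftyThetaEnv ι = E.inftyThetaEnv ι') :
    (E.inftyThetaMonoid ι).map (E.conj g).toMonoidHom = E.inftyThetaMonoid ι' := by
  unfold ThetaEnvData.inftyThetaMonoid splitMonoid
  rw [Submonoid.map_sup, map_units_eq_of_stable E g hU, MonoidHom.map_mclosure]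
  congr 2

/-- **IUTchII:Prop3.1(i)** (kurims p.87) the field `Prop31Statements.conj_permutes` DISCHARGED modulo its
inputs: if the conjugation action stabilises `M^×_TM` and permutes the input subsets `{θ^ι_env}_ι`,
it permutes the theta monoids `{Ψ^ι_env}_ι`. [cite: Mochizuki2012, Prop 3.1 (i) p.87] -/
theorem conj_permutes_of_thetaEnv (hU : ∀ (g : P) (x : E.H), x ∈ E.units → E.conj g x ∈ E.units)
    (hperm : ∀ (g : P) (ι : E.Iota), ∃ ι' : E.Iota, E.conj g '' E.thetaEnv ι = E.thetaEnv ι') :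
    ∀ (g : P) (ι : E.Iota), ∃ ι' : E.Iota,
      (E.thetaMonoid ι).map (E.conj g).toMonoidHom = E.thetaMonoid ι' := by
  intro g ι
  obtain ⟨ι', hι'⟩ := hperm g ι
  exact ⟨ι', thetaMonoid_map_conj E g hU hι'⟩

/-- **IUTchII:Prop3.1(i)** (kurims p.87) the field `Prop31Statements.splitting` DISCHARGED modulo a
divisor map: if `v` kills `M^×_TM` and is `> 1` on every element of every `∞θ^ι_env`, then each
`(M^×_TM, ⟨∞θ^ι_env⟩)` is a splitting up to torsion. [cite: Mochizuki2012, Prop 3.1 (i) p.87] -/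
theorem thetaEnv_splitting_of_val {Γ : Type w} [CommMonoid Γ] [PartialOrder Γ]
    [IsOrderedMonoid Γ] (v : E.H →* Γ) (hU : ∀ u ∈ E.units, v u = 1)
    (hpos : ∀ (ι : E.Iota), ∀ t ∈ E.inftyThetaEnv ι, 1 < v t) (ι : E.Iota) :
    IsSplittingUpToTorsion E.units (Submonoid.closure (E.inftyThetaEnv ι)) :=
  isSplittingUpToTorsion_closure_of_val v E.units _ hU (hpos ι)

/-! ### 3. Proposition 3.1 (ii): the constant monoid `Ψ_cns = M_TM ⊇ M^×_TM` -/

/-- **IUTchII:Prop3.1(ii)** (kurims p.88) `M^×_TM ⊆ M_TM = Ψ_cns`. [cite: Mochizuki2012, Prop 3.1 (ii) p.88] -/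
theorem units_le_constantMonoid : E.units.toSubmonoid ≤ E.constantMonoid :=
  fun x hx => ((E.units_eq x).mp hx).1

/-- **IUTchII:Prop3.1(ii)** (kurims p.88) `M^×_TM` is the group of units of the monoid `M_TM = Ψ_cns`: an
element of the constant monoid is invertible in it iff it lies in `M^×_TM`.
[cite: Mochizuki2012, Prop 3.1 (ii) p.88] -/
theorem isUnit_constantMonoid_iff (x : E.constantMonoid) : IsUnit x ↔ (x : E.H) ∈ E.units := by
  rw [E.units_eq]
  constructor
  · rintro ⟨w, hw⟩
    refine ⟨hw ▸ w.val.2, ?_⟩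
    have h : (w.inv : E.H) = (x : E.H)⁻¹ := by
      rw [eq_inv_iff_mul_eq_one, ← hw]
      exact congrArg Subtype.val w.inv_val
    exact h ▸ w.inv.2
  · rintro ⟨hx, hxinv⟩
    exact ⟨⟨x, ⟨(x : E.H)⁻¹, hxinv⟩, Subtype.ext (mul_inv_cancel _), Subtype.ext (inv_mul_cancel _)⟩,
      rfl⟩

/-- **IUTchII:Prop3.1(ii)** (kurims p.88) "equipped with a natural conjugation action": stability of
the constant monoid `M_TM` under the action implies stability of its unit group `M^×_TM` — so the
single field `Prop31Statements.constants_stable` also yields the unit stability used in (i).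
[cite: Mochizuki2012, Prop 3.1 (ii) p.88] -/
theorem units_conjStable_of_constants (h : E.IsConjStable E.constantMonoid) :
    ∀ (g : P) (x : E.H), x ∈ E.units → E.conj g x ∈ E.units := by
  intro g x hx
  rw [E.units_eq] at hx ⊢
  have h2 : (E.conj g x)⁻¹ ∈ E.constantMonoid := by simpa [map_inv] using h g x⁻¹ hx.2
  exact ⟨h g x hx.1, h2⟩

/-- ASSEMBLY, **IUTchII:Prop3.1(i)**/(ii) (kurims pp.87–88): the `Prop`-valued statement structure
`Prop31Statements` of the statement file HOLDS for any input data in which (a) the conjugation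
action stabilises the constant monoid and permutes the input subsets `θ^ι_env`, and (b) a divisor
map kills the units and is positive on the `∞θ^ι_env` — the shape in which Prop 1.5 (iii) / Cor 2.8
(i) / Prop 2.2 (i) deliver the inputs. [cite: Mochizuki2012, Prop 3.1 p.87] -/
theorem prop31Statements_of_val {Γ : Type w} [CommMonoid Γ] [PartialOrder Γ] [IsOrderedMonoid Γ]
    (hcns : E.IsConjStable E.constantMonoid)
    (hperm : ∀ (g : P) (ι : E.Iota), ∃ ι' : E.Iota, E.conj g '' E.thetaEnv ι = E.thetaEnv ι')
    (v : E.H →* Γ) (hU : ∀ u ∈ E.units, v u = 1)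
    (hpos : ∀ (ι : E.Iota), ∀ t ∈ E.inftyThetaEnv ι, 1 < v t) : Prop31Statements E where
  conj_permutes := conj_permutes_of_thetaEnv E (units_conjStable_of_constants E hcns) hperm
  splitting := thetaEnv_splitting_of_val E v hU hpos
  constants_stable := hcns

end Prop31

/-! ### 4. Example 3.2 (i): the monoids `Ψ_{F^Θ_v,α}`, `∞Ψ_{F^Θ_v,α}` from a tempered Frobenioid -/

section Example32

variable {P : Type u} [Group P] (F : TemperedFrobenioidThetaData.{u, v} P)

/-- The image of `O^×_{C^Θ_v}(A^Θ_∞)` under a conjugation that stabilises it (both directions) is itself.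
[folklore] -/
private theorem map_frobUnits_eq_of_stable (β : P)
    (hU : ∀ (g : P) (x : F.K), x ∈ F.units → F.conj g x ∈ F.units) :
    F.units.toSubmonoid.map (F.conj β).toMonoidHom = F.units.toSubmonoid := by
  ext x
  simp only [Submonoid.mem_map, Subgroup.mem_toSubmonoid, MulEquiv.toMonoidHom_eq_coe,
    MonoidHom.coe_coe]
  constructor
  · rintro ⟨y, hy, rfl⟩; exact hU β y hy
  · intro hx
    refine ⟨(F.conj β).symm x, ?_, by simp⟩
    have := hU β⁻¹ x hx
    rwa [map_inv, MulAut.inv_def] at this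

/-- **IUTchII:Ex3.2(i)** (kurims p.89) "a natural conjugation action of `Π_v` on the collections of
submonoids … `∞Ψ_{F^Θ_v} = {∞Ψ_{F^Θ_v,α}}_{α ∈ Π_v}`": `β · ∞Ψ_{F^Θ_v,α} = ∞Ψ_{F^Θ_v,βα}` when the units are
conjugation-stable (the `∞`-companion of the statement file's `frobThetaMonoid_conj`).
[cite: Mochizuki2012, Ex 3.2 (i) p.89] -/
theorem inftyFrobThetaMonoid_conj
    (hU : ∀ (g : P) (x : F.K), x ∈ F.units → F.conj g x ∈ F.units) (β α : P) :
    (F.inftyFrobThetaMonoid α).map (F.conj β).toMonoidHom = F.inftyFrobThetaMonoid (β * α) := by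
  unfold TemperedFrobenioidThetaData.inftyFrobThetaMonoid splitMonoid
  rw [Submonoid.map_sup, map_frobUnits_eq_of_stable F β hU, rootPowers_map_mulEquiv, map_mul]
  rfl

/-- **IUTchII:Ex3.2(i)** (kurims p.89) the conjugation action on the PAIR of collections
`(Ψ_{F^Θ_v}, ∞Ψ_{F^Θ_v})`: `β` carries the `α`-component onto the `βα`-component.
[cite: Mochizuki2012, Ex 3.2 (i) p.89] -/
theorem frobThetaCollection_conj
    (hU : ∀ (g : P) (x : F.K), x ∈ F.units → F.conj g x ∈ F.units) (β α : P) :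
    ((F.frobThetaCollection α).1.map (F.conj β).toMonoidHom,
      (F.frobThetaCollection α).2.map (F.conj β).toMonoidHom) = F.frobThetaCollection (β * α) :=
  Prod.ext (F.frobThetaMonoid_conj hU β α) (inftyFrobThetaMonoid_conj F hU β α)

/-- **IUTchII:Ex3.2(i)** (kurims p.89) "characteristic splittings, up to torsion, … compatible with
the action of `Π_v`": once the units are `Π_v`-stable, the splitting clause at every conjugate `Θ^α_v`
follows from (indeed is equivalent to) the clause at `Θ_v` itself. [cite: Mochizuki2012, Ex 3.2 (i) p.89] -/
theorem splitting_conj_iff (hU : ∀ (g : P) (x : F.K), x ∈ F.units → F.conj g x ∈ F.units) :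
    (∀ α : P, IsSplittingUpToTorsion F.units (rootPowers (F.conj α F.theta))) ↔
      IsSplittingUpToTorsion F.units (rootPowers F.theta) := by
  constructor
  · intro h
    simpa using h 1
  · intro h α
    have h' := IsSplittingUpToTorsion.map (F.conj α) h (fun x hx => by
      have := hU α⁻¹ x hx
      rwa [map_inv, MulAut.inv_def] at this)
    rwa [rootPowers_map_mulEquiv] at h'

/-- **IUTchII:Ex3.2(i)** (kurims p.89) DIVISOR-MAP FORM: if a homomorphism `v` ("order of the divisor",
[IUTchI] Ex 3.2 (v)) kills `O^×_{C^Θ_v}(A^Θ_∞)` and `1 < v(Θ_v)`, and the units are `Π_v`-stable, then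
`Θ^{ℚ≥0}_v` determines splittings up to torsion of every `∞Ψ_{F^Θ_v,α}` (hence of every `Ψ_{F^Θ_v,α}`).
[cite: Mochizuki2012, Ex 3.2 (i) p.89] -/
theorem frobTheta_splitting_of_val {Γ : Type w} [CommMonoid Γ] [PartialOrder Γ]
    [IsOrderedMonoid Γ] (hU : ∀ (g : P) (x : F.K), x ∈ F.units → F.conj g x ∈ F.units)
    (v : F.K →* Γ) (hv : ∀ u ∈ F.units, v u = 1) (hθ : 1 < v F.theta) (α : P) :
    IsSplittingUpToTorsion F.units (rootPowers (F.conj α F.theta)) :=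
  (splitting_conj_iff F hU).mpr (isSplittingUpToTorsion_rootPowers_of_val v F.units F.theta hv hθ) α

/-- **IUTchII:Ex3.2(i)** (kurims p.89): with `Π_v`-stable units and base monoid, the whole statement
structure `Example32Statements` is EQUIVALENT to its splitting clause at `α = 1`.
[cite: Mochizuki2012, Ex 3.2 (i) p.89] -/
theorem example32Statements_iff_id
    (hU : ∀ (g : P) (x : F.K), x ∈ F.units → F.conj g x ∈ F.units)
    (hB : ∀ (g : P) (x : F.K), x ∈ F.baseMonoid → F.conj g x ∈ F.baseMonoid) :
    Example32Statements F ↔ IsSplittingUpToTorsion F.units (rootPowers F.theta) := by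
  constructor
  · intro h
    exact (splitting_conj_iff F hU).mp h.splitting
  · intro h
    exact ⟨(splitting_conj_iff F hU).mpr h, hU, hB⟩

/-- ASSEMBLY, **IUTchII:Ex3.2(i)**/(ii) (kurims pp.88–89): `Example32Statements` HOLDS for any input
data with `Π_v`-stable units and base monoid and a divisor map killing the units with `1 < v(Θ_v)`.
The base monoid `Ψ_{C_v} = O^▷_{C_v}(A^Θ_∞)` of (ii) and its `Π_v`-action are INPUT fields (SLOT: NEEDS
[IUTchI] Ex 3.2 (iii), [FrdI] Prop 2.2). [cite: Mochizuki2012, Ex 3.2 p.88] -/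
theorem example32Statements_of_val {Γ : Type w} [CommMonoid Γ] [PartialOrder Γ] [IsOrderedMonoid Γ]
    (hU : ∀ (g : P) (x : F.K), x ∈ F.units → F.conj g x ∈ F.units)
    (hB : ∀ (g : P) (x : F.K), x ∈ F.baseMonoid → F.conj g x ∈ F.baseMonoid)
    (v : F.K →* Γ) (hv : ∀ u ∈ F.units, v u = 1) (hθ : 1 < v F.theta) : Example32Statements F :=
  (example32Statements_iff_id F hU hB).mpr
    (isSplittingUpToTorsion_rootPowers_of_val v F.units F.theta hv hθ)

end Example32

end TemperedThetaMonoids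

end Literature.IUT.HodgeArakelov
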